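import Summits.AtomisticToContinuum.FouriersLaw.Theses.VanishingNoiseTransfer
import Summits.AtomisticToContinuum.FouriersLaw.Theorems.VanishingNoiseTransferNoiseLocalityStubResponseDensityNoisyAux1
import Summits.AtomisticToContinuum.FouriersLaw.Theorems.VanishingNoiseTransferNoiseLocalityStubResponseDensityNoisyDyson8
import Summits.AtomisticToContinuum.FouriersLaw.Theorems.VanishingNoiseTransferNoiseLocalityStubResponseDensityNoisyDyson9
import Summits.AtomisticToContinuum.FouriersLaw.Theorems.VanishingNoiseTransferNoiseLocalityStubResponseDensityNoisyDyson10
import Summits.AtomisticToContinuum.FouriersLaw.Theorems.OddSectorIrreversibilityResponseDensityAssembly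
import Literature.MathematicalPhysics.KineticTheory.VelocityFlipNoise

/-!
# Stub `stub_responseDensityNoisy` (line `relative-flip-energy-transfer`, crux `NoiseLocality`): the
response density of the unique flip-noisy steady family — CLOSED

Registered stub 1b of the reduction skeleton of crux stmt-AtomisticToContinuum-11975 (`NoiseLocality`,
route `VanishingNoiseTransfer`): for the pinned anharmonic chain between Langevin baths with velocity
flips at rate `ε > 0`, the unique weak flip steady family `μ` (hypothesis) has an `L²(μ_T)` response
density `U` at equal temperatures: `d/dδ ∫ g dμ_{T+δ/2,T-δ/2}|₀ = ∫ g U dμ_T` for `g ∈ C_c^∞`, and the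
same for the total current. `N ≤ 1`: `of_le_one` (`…Aux1`). `N ≥ 2` (`hasDerivAt_of_two_le`):

1. The flip-noisy steady state IS the embedded-chain construction of the tree: `μ_δ = π_δ R_δ` with
   `R_δ` the resolvent kernel at rate `Nε` of the flip-free dynamics with baths at `T ± δ/2` and `π_δ`
   the invariant law of the embedded flip chain `K_δ = Q ∘ₖ R_δ`
   (`pinnedChain_exists_invariant_embeddedFlipKernel`, `pinnedChain_isFlipSteadyState_bind_resolventKernel`,
   and the UNIQUENESS hypothesis).
2. The EXACT response identity (`…Dyson8`): `μ_δ(φ) - μ_T(φ) = δ (γ/2T²)(Nε)⁻¹ ∑ₙ μ_T(g · Kⁿ_δ R_δ φ)`,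
   `g = p_0² - p_{N-1}²` (Poisson equation of `K_δ` against `μ_T`, the resolvent response identity of
   the flip-free kernels `…Dyson4`, `μ_T(Q ·) = μ_T`, `μ_T(g) = 0`), the series converging geometrically
   and uniformly in `δ` (uniform Harris bounds, `…Dyson1–2, 7`).
3. The series is continuous in `δ` (`…Dyson9`: weighted joint Feller continuity `…Dyson3`), so the
   difference quotient converges to `(γ/2T²)(Nε)⁻¹ ∑ₙ μ_T(g · Kⁿ_0 R_0 φ)`.
4. At equilibrium this functional has the density `U = (γ/2T²)(Nε)⁻¹ (∑ₙ Kⁿ_0 R_0 g) ∘ Θ ∈ L²(μ_T)`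
   (`…Dyson10`: the palindrome duality `…Dyson5–6`, `π_T(R_0 g) = 0`).

No definitions.
-/

noncomputable section

open MeasureTheory ProbabilityTheory Filter Topology Set
open scoped NNReal ENNReal ContDiff

namespace Summit.AtomisticToContinuum.FouriersLaw.Theorems.NoiseLocality

open Literature.MathematicalPhysics.KineticTheory.HeatConduction
open Literature.Probability.Process Literature.MathematicalPhysics.KineticTheory OscillatorChain

namespace StubResponseDensityNoisy.Dyson

variable {N : ℕ}

section Main

variable {ω₂ lam β γ : ℝ} (hω : 0 < ω₂) (hl : 0 < lam) (hβ : 0 < β) (hγ : 0 < γ) (hN2 : 1 < N)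
  {T : ℝ} (hT : 0 < T) {ε : ℝ} (hε : 0 < ε)
include hω hl hβ hγ hN2 hT hε

set_option maxHeartbeats 1600000 in
/-- **The response density of the flip-noisy steady family, `N ≥ 2`.** With `ϑ = 1/(16T)`: if `μ`
is the unique weak flip steady family at rate `ε`, there is `U ∈ L²(μ_T)`, `|U| ≤ C_U e^{ϑH}`, such
that for every continuous `φ` with `|φ| ≤ C e^{ϑH}`:
`HasDerivAt (δ ↦ ∫ φ dμ_{T+δ/2,T-δ/2}) (∫ φ U dμ_T) 0`. -/
theorem hasDerivAt_of_two_le (μ : ℝ → ℝ → Measure (PhaseSpace N))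
    (hμ : ∀ T_L T_R : ℝ, 0 < T_L → 0 < T_R →
      (pinnedChain ω₂ lam β γ).IsFlipSteadyState N T_L T_R ε (μ T_L T_R) ∧
        ∀ ν : Measure (PhaseSpace N), (pinnedChain ω₂ lam β γ).IsFlipSteadyState N T_L T_R ε ν → ν = μ T_L T_R) :
    ∃ U : PhaseSpace N → ℝ, MemLp U 2 ((pinnedChain ω₂ lam β γ).gibbsMeasure N T) ∧
      ∀ {φ : PhaseSpace N → ℝ}, Continuous φ → ∀ {C : ℝ}, 0 ≤ C →
        (∀ y, |φ y| ≤ C * Real.exp (1 / (16 * T) * (pinnedChain ω₂ lam β γ).hamiltonian N y)) →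
        HasDerivAt (fun δ : ℝ => ∫ x, φ x ∂(μ (T + δ / 2) (T - δ / 2)))
          (∫ x, φ x * U x ∂((pinnedChain ω₂ lam β γ).gibbsMeasure N T)) 0 := by
  have hN : 0 < N := Nat.zero_lt_of_lt hN2
  set ϑ : ℝ := 1 / (16 * T) with hϑdef
  have hϑ : 0 < ϑ := by positivity
  have h2ϑT : 2 * ϑ < 1 / (2 * T) := by
    rw [hϑdef, show 2 * (1 / (16 * T)) = 1 / (8 * T) by field_simp; ring]
    exact one_div_lt_one_div_of_lt (by positivity) (by linarith)
  have hϑT : ϑ < 1 / (2 * T) := theta_lt_of_two_theta_lt hϑ h2ϑT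
  have hr : (0 : ℝ) < N * ε := by positivity
  set c : ℝ := γ / (2 * T ^ 2) * ((N : ℝ) * ε)⁻¹ with hc
  -- the equilibrium density (…Dyson10) and the exact identity (…Dyson8)
  obtain ⟨U, ⟨_CU, _hUb⟩, hUL2, hUD⟩ := exists_responseDensity hω hl hβ hγ (Nat.zero_lt_of_lt hN2) hT hϑ h2ϑT hr
  obtain ⟨abar, CB, _h0, _h1, _hCB, hE⟩ := exact_response_identity hω hl hβ hγ (Nat.zero_lt_of_lt hN2) hT hϑ h2ϑT hr
  refine ⟨U, hUL2, fun {φ} hφ {C} hC hφb => ?_⟩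
  -- (1) identification of the steady family with the embedded-chain construction, and the identity
  have hkey : ∀ (δ : ℝ) (hδ : |δ| < T),
      (∫ x, φ x ∂(μ (T + δ / 2) (T - δ / 2))) - ∫ x, φ x ∂((pinnedChain ω₂ lam β γ).gibbsMeasure N T) =
        δ * (γ / (2 * T ^ 2)) * ((N : ℝ) * ε)⁻¹ * ∑' n : ℕ, ∫ x, (x.2 ⟨0, Nat.zero_lt_of_lt hN2⟩ ^ 2 - x.2 ⟨N - 1, by omega⟩ ^ 2) *
          (∫ y, (∫ z, φ z ∂((pinnedChainSemigroup hω hl.le hβ.le hγ.le (Nat.zero_lt_of_lt hN2)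
            ((half_pos hT).le.trans (bath_window hT hδ).2.2.2.2.1) ((half_pos hT).le.trans (bath_window hT hδ).2.2.2.2.2)).resolventKernel (N * ε) y))
            ∂((((pinnedChainSemigroup hω hl.le hβ.le hγ.le (Nat.zero_lt_of_lt hN2)
              ((half_pos hT).le.trans (bath_window hT hδ).2.2.2.2.1) ((half_pos hT).le.trans (bath_window hT hδ).2.2.2.2.2)).embeddedFlipKernel (N * ε)) ^ n) x))
          ∂((pinnedChain ω₂ lam β γ).gibbsMeasure N T) := by
    intro δ hδ
    obtain ⟨hL0, hL', hR0, hR', -, -⟩ := bath_window hT hδ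
    have hϑ' : ϑ < 1 / max (T + δ / 2) (T - δ / 2) := theta_lt_inv_max hϑT hL0 hL' hR'
    obtain ⟨π, hπ, hinv, hfin⟩ := pinnedChain_exists_invariant_embeddedFlipKernel hω hl hβ hγ hN2 hL0 hR0 hr hϑ hϑ'
    haveI := hπ
    have hss := pinnedChain_isFlipSteadyState_bind_resolventKernel hω hl hβ hγ hN2 hL0 hR0 hε hϑ hϑ' π hinv hfin
    have hident := (hμ _ _ hL0 hR0).2 _ hss
    have hinv' : Kernel.Invariant ((pinnedChainSemigroup hω hl.le hβ.le hγ.le (Nat.zero_lt_of_lt hN2)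
        ((half_pos hT).le.trans (bath_window hT hδ).2.2.2.2.1) ((half_pos hT).le.trans (bath_window hT hδ).2.2.2.2.2)).embeddedFlipKernel (N * ε)) π := hinv
    have hident' : π.bind ((pinnedChainSemigroup hω hl.le hβ.le hγ.le (Nat.zero_lt_of_lt hN2)
        ((half_pos hT).le.trans (bath_window hT hδ).2.2.2.2.1) ((half_pos hT).le.trans (bath_window hT hδ).2.2.2.2.2)).resolventKernel (N * ε)) =
        μ (T + δ / 2) (T - δ / 2) := hident
    rw [← hident']
    exact (hE δ hδ π hπ hinv' φ hφ C hC hφb).2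
  -- (2) the clamped series and its continuity (…Dyson9)
  have hScl := continuous_responseSeries hω hl hβ hγ hN2 hT hϑ h2ϑT hr hφ hC hφb
  -- (3) the slope: for `0 < |δ| < T` it is `c · S(δ) = c · S_cl(δ)`
  have hval0 : ∫ x, φ x ∂(μ (T + 0 / 2) (T - 0 / 2)) = ∫ x, φ x ∂((pinnedChain ω₂ lam β γ).gibbsMeasure N T) := by
    have h := hkey 0 (by simpa using hT)
    rw [zero_mul, zero_mul, zero_mul] at h
    linarith
  have hslope : ∀ δ : ℝ, |δ| < T → δ ≠ 0 →
      slope (fun δ : ℝ => ∫ x, φ x ∂(μ (T + δ / 2) (T - δ / 2))) 0 δ =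
        c * ∑' n : ℕ, ∫ x, (x.2 ⟨0, Nat.zero_lt_of_lt hN2⟩ ^ 2 - x.2 ⟨N - 1, by omega⟩ ^ 2) *
          (∫ y, (∫ z, φ z ∂((pinnedChainSemigroup hω hl.le hβ.le hγ.le (Nat.zero_lt_of_lt hN2)
            (clamp_window hT δ).1.le (clamp_window hT δ).2.2.1.le).resolventKernel (N * ε) y))
            ∂((((pinnedChainSemigroup hω hl.le hβ.le hγ.le (Nat.zero_lt_of_lt hN2)
              (clamp_window hT δ).1.le (clamp_window hT δ).2.2.1.le).embeddedFlipKernel (N * ε)) ^ n) x))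
          ∂((pinnedChain ω₂ lam β γ).gibbsMeasure N T) := by
    intro δ hδ hδ0
    rw [slope_def_field, sub_zero, hval0, hkey δ hδ]
    -- the kernels with baths at `T ± δ/2` and at `T ± δ̂/2` coincide
    have ecl : max (-T) (min T δ) = δ := clamp_eq hδ.le
    have eL : T + δ / 2 = T + max (-T) (min T δ) / 2 := by rw [ecl]
    have eR : T - δ / 2 = T - max (-T) (min T δ) / 2 := by rw [ecl]
    rw [resolventKernel_congr hω hl.le hβ.le hγ.le (Nat.zero_lt_of_lt hN2)
        ((half_pos hT).le.trans (bath_window hT hδ).2.2.2.2.1) ((half_pos hT).le.trans (bath_window hT hδ).2.2.2.2.2)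
        (clamp_window hT δ).1.le (clamp_window hT δ).2.2.1.le eL eR (N * ε),
      embeddedFlipKernel_congr hω hl.le hβ.le hγ.le (Nat.zero_lt_of_lt hN2)
        ((half_pos hT).le.trans (bath_window hT hδ).2.2.2.2.1) ((half_pos hT).le.trans (bath_window hT hδ).2.2.2.2.2)
        (clamp_window hT δ).1.le (clamp_window hT δ).2.2.1.le eL eR (N * ε)]
    rw [hc]
    field_simp
  -- (4) the value at `δ = 0` of the clamped series is the equilibrium series, with density `U`
  have hlim : c * ∑' n : ℕ, ∫ x, (x.2 ⟨0, Nat.zero_lt_of_lt hN2⟩ ^ 2 - x.2 ⟨N - 1, by omega⟩ ^ 2) *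
      (∫ y, (∫ z, φ z ∂((pinnedChainSemigroup hω hl.le hβ.le hγ.le (Nat.zero_lt_of_lt hN2)
        (clamp_window hT 0).1.le (clamp_window hT 0).2.2.1.le).resolventKernel (N * ε) y))
        ∂((((pinnedChainSemigroup hω hl.le hβ.le hγ.le (Nat.zero_lt_of_lt hN2)
          (clamp_window hT 0).1.le (clamp_window hT 0).2.2.1.le).embeddedFlipKernel (N * ε)) ^ n) x))
      ∂((pinnedChain ω₂ lam β γ).gibbsMeasure N T) = ∫ x, φ x * U x ∂((pinnedChain ω₂ lam β γ).gibbsMeasure N T) := by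
    have e0 : max (-T) (min T (0 : ℝ)) = 0 := clamp_eq (by simpa using hT.le)
    have eL : T + max (-T) (min T (0 : ℝ)) / 2 = T := by rw [e0]; ring
    have eR : T - max (-T) (min T (0 : ℝ)) / 2 = T := by rw [e0]; ring
    rw [resolventKernel_congr hω hl.le hβ.le hγ.le (Nat.zero_lt_of_lt hN2)
        (clamp_window hT 0).1.le (clamp_window hT 0).2.2.1.le hT.le hT.le eL eR (N * ε),
      embeddedFlipKernel_congr hω hl.le hβ.le hγ.le (Nat.zero_lt_of_lt hN2)
        (clamp_window hT 0).1.le (clamp_window hT 0).2.2.1.le hT.le hT.le eL eR (N * ε)]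
    rw [hc, mul_assoc]
    have h := hUD hφ hC hφb
    rw [mul_assoc] at h
    exact h
  -- (5) conclusion
  rw [hasDerivAt_iff_tendsto_slope]
  have hev : ∀ᶠ δ in 𝓝[≠] (0 : ℝ), |δ| < T ∧ δ ≠ 0 := by
    have h1 : ∀ᶠ δ in 𝓝[≠] (0 : ℝ), |δ| < T := by
      have : Metric.ball (0 : ℝ) T ∈ 𝓝 (0 : ℝ) := Metric.ball_mem_nhds 0 hT
      refine mem_nhdsWithin_of_mem_nhds (Filter.mem_of_superset this fun δ hδ => ?_)
      simpa [Real.dist_eq] using hδ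
    exact h1.and self_mem_nhdsWithin
  refine Tendsto.congr' (hev.mono fun δ hδ => (hslope δ hδ.1 hδ.2).symm) ?_
  rw [← hlim]
  exact ((hScl.tendsto 0).const_mul c).mono_left nhdsWithin_le_nhds

end Main

end StubResponseDensityNoisy.Dyson

/-- Registered stub 1b `stub_responseDensityNoisy` — **the response density of the unique flip-noisy
steady family**: for the pinned chain with velocity flips at rate `ε > 0`, if `μ` is the unique weak
flip steady family then there is `U ∈ L²(μ_T)` with `d/dδ ∫ g dμ_{T+δ/2,T-δ/2}|₀ = ∫ g U dμ_T` for all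
`g ∈ C_c^∞` and `d/dδ J(μ_{T+δ/2,T-δ/2})|₀ = ∑_i ∫ j_i U dμ_T`. `N ≤ 1`: `of_le_one`; `N ≥ 2`:
`Dyson.hasDerivAt_of_two_le` (embedded flip chain, exact response identity, uniform Harris bounds). -/
theorem stub_responseDensityNoisy :
    ∀ ω₂ lam β γ : ℝ, 0 < ω₂ → 0 < lam → 0 < β → 0 < γ → ∀ T : ℝ, 0 < T → ∀ (N : ℕ) (ε : ℝ), 0 < ε →
    ∀ μ : ℝ → ℝ → MeasureTheory.Measure (Literature.MathematicalPhysics.KineticTheory.HeatConduction.PhaseSpace N),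
    (∀ T_L T_R : ℝ, 0 < T_L → 0 < T_R →
      (Literature.MathematicalPhysics.KineticTheory.HeatConduction.pinnedChain ω₂ lam β γ).IsFlipSteadyState N T_L T_R ε
          (μ T_L T_R) ∧
        ∀ ν : MeasureTheory.Measure (Literature.MathematicalPhysics.KineticTheory.HeatConduction.PhaseSpace N),
          (Literature.MathematicalPhysics.KineticTheory.HeatConduction.pinnedChain ω₂ lam β γ).IsFlipSteadyState
              N T_L T_R ε ν → ν = μ T_L T_R) →
    ∃ U : Literature.MathematicalPhysics.KineticTheory.HeatConduction.PhaseSpace N → ℝ,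
      MeasureTheory.MemLp U 2
          ((Literature.MathematicalPhysics.KineticTheory.HeatConduction.pinnedChain ω₂ lam β γ).gibbsMeasure N T) ∧
        (∀ g : Literature.MathematicalPhysics.KineticTheory.HeatConduction.PhaseSpace N → ℝ,
          ContDiff ℝ ((⊤ : ℕ∞) : WithTop ℕ∞) g → HasCompactSupport g →
            HasDerivAt (fun δ : ℝ => ∫ x, g x ∂(μ (T + δ / 2) (T - δ / 2)))
              (∫ x, g x * U x
                ∂((Literature.MathematicalPhysics.KineticTheory.HeatConduction.pinnedChain ω₂ lam β γ).gibbsMeasure N T))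
              0) ∧
        HasDerivAt (fun δ : ℝ =>
            (Literature.MathematicalPhysics.KineticTheory.HeatConduction.pinnedChain ω₂ lam β γ).totalCurrent
              (μ (T + δ / 2) (T - δ / 2)))
          (∑ i : Fin N, ∫ x,
            (Literature.MathematicalPhysics.KineticTheory.HeatConduction.pinnedChain ω₂ lam β γ).bondCurrent N i x * U x
              ∂((Literature.MathematicalPhysics.KineticTheory.HeatConduction.pinnedChain ω₂ lam β γ).gibbsMeasure N T))
          0 := by
  intro ω₂ lam β γ hω hl hβ hγ T hT N ε hε μ hμ
  rcases Nat.lt_or_ge N 2 with hN | hN2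
  · exact StubResponseDensityNoisy.of_le_one (pinnedChain ω₂ lam β γ) (Nat.lt_succ_iff.mp hN) hT ε μ hμ
  · have hN2' : 1 < N := hN2
    obtain ⟨U, hUL2, hder⟩ := StubResponseDensityNoisy.Dyson.hasDerivAt_of_two_le hω hl hβ hγ hN2' hT hε μ hμ
    have hϑ : (0 : ℝ) < 1 / (16 * T) := by positivity
    have hone : ∀ y : PhaseSpace N, (1 : ℝ) ≤ Real.exp (1 / (16 * T) * (pinnedChain ω₂ lam β γ).hamiltonian N y) :=
      fun y => Real.one_le_exp (mul_nonneg hϑ.le (pinnedChain_hamiltonian_nonneg hω.le hl.le hβ.le γ N y))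
    refine ⟨U, hUL2, fun g hg hgc => ?_, ?_⟩
    · obtain ⟨C0, hC0⟩ := hg.continuous.bounded_above_of_compact_support hgc
      refine hder hg.continuous (C := max C0 0) (le_max_right _ _) fun y => ?_
      calc |g y| ≤ max C0 0 := (Real.norm_eq_abs _ ▸ hC0 y).trans (le_max_left _ _)
        _ = max C0 0 * 1 := (mul_one _).symm
        _ ≤ _ := mul_le_mul_of_nonneg_left (hone y) (le_max_right _ _)
    · have hJ : ∀ i : Fin N, HasDerivAt (fun δ : ℝ => ∫ x, (pinnedChain ω₂ lam β γ).bondCurrent N i x ∂(μ (T + δ / 2) (T - δ / 2)))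
          (∫ x, (pinnedChain ω₂ lam β γ).bondCurrent N i x * U x ∂((pinnedChain ω₂ lam β γ).gibbsMeasure N T)) 0 := by
        intro i
        obtain ⟨C, hC⟩ := pinnedChain_abs_bondCurrent_le_exp hω hl.le hβ.le γ N hϑ i
        refine hder (pinnedChain_contDiff_bondCurrent γ N i).continuous (C := max C 0) (le_max_right _ _) fun y => ?_
        exact (hC y).trans (mul_le_mul_of_nonneg_right (le_max_left _ _) (Real.exp_pos _).le)
      have h := HasDerivAt.fun_sum (u := Finset.univ) fun i _ => hJ i
      exact h

end Summit.AtomisticToContinuum.FouriersLaw.Theorems.NoiseLocality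

end
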